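import Mathlib
import Literature.Analysis.FluidPDE.ClassicalSolution
import Literature.Analysis.FluidPDE.SpaceTimeCalculus
import Summits.NavierStokesRegularity.NavierStokesRegularity.Theorems.TautLoopKelvinTautLoopLawStepSixPointTools
import Summits.NavierStokesRegularity.NavierStokesRegularity.Theorems.TautLoopKelvinTautLoopLawStepFlowTaylorToolsAux
import Summits.NavierStokesRegularity.NavierStokesRegularity.Theorems.TautLoopKelvinTautLoopLawStepOneStepTools
import HarnessLib

/-!
# Route `TautLoopKelvin`, crux `TautLoopLaw` (stmt-NavierStokesRegularity-15249), line
  `Sketch-ideas-r1k1` (Dini–Saks architecture) — tools stub `stub_tautLoopStepSplittingTools`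

**Field side of the random-walk splitting.** On `[a, b]` (`b - a ≤ 1`) split into `n` equal
sub-intervals `[sₖ, sₖ₊₁]`, `sₖ = a + k τ`, `τ = (b - a)/n`, consider the scheme
`θ₀ = u(a)`, `θₖ₊₁ = Tₖ(M θₖ)`, where `M g(y) = ⅙ Σᵢ (g(y + c eᵢ) + g(y − c eᵢ))` is the
six-point average of step `c = √(6ντ)` and `Tₖ g(x) = (DAₖ(x))† g(Aₖ x)` is the exact 1-form
transport by the backward flow `Aₖ = Xₖ(sₖ)` of `u` over the `k`-th sub-interval
(`Xₖ(sₖ₊₁) = id`). For a classical Navier–Stokes solution `(u, p)` (viscosity `ν > 0`, zero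
force) with `‖Dʲu‖ ≤ Bⱼ` (`j ≤ 4`) and `u`, `Du`, `D²u` time-Lipschitz with constant `Bt`:

  `θₙ = u(b) + ∇Q + E`,  `‖E‖∞ ≤ K (b − a)²/n`,  `K = K(ν, B₀, …, B₄, Bt)`.

Mechanism (a discrete Duhamel / Lax principle "consistency + stability ⇒ convergence", modulo
gradients): the landed one-step consistency `stub_tautLoopStepOneStepTools` gives
`Tₖ(M u(sₖ)) = u(sₖ₊₁) + ∇qₖ + rₖ`, `‖rₖ‖∞ ≤ K₁ τ²`; the map `g ↦ Tₖ(M g)` is linear, maps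
gradients to gradients *exactly* (`M ∇Q = ∇(M Q)`, `tautLoopSix_gradient_average`, and the
adjoint chain rule `(DA(x))† ∇P(A x) = ∇(P ∘ A)(x)`), and is sup-norm stable with constant
`‖DAₖ‖∞ ≤ e^{B₁ τ}` (`tautLoopFlowT_fderiv_apply_le`, `tautLoopSix_sup_le`, `‖L†‖ = ‖L‖`). By
induction `θₖ = u(sₖ) + ∇Qₖ + Eₖ` with `‖Eₖ‖∞ ≤ k K₁ τ² e^{B₁ τ k}`, whence
`‖Eₙ‖∞ ≤ K₁ e^{B₁ (b − a)} (b − a)²/n ≤ K₁ e^{B₁} (b − a)²/n`.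

Folklore numerical analysis of splitting / random-vortex schemes (A. J. Chorin, *Numerical study
of slightly viscous flow*, J. Fluid Mech. 57 (1973), §2; A. J. Majda, A. L. Bertozzi, *Vorticity
and Incompressible Flow* (2002), §3.4; the Lax equivalence principle, P. D. Lax,
R. D. Richtmyer, Comm. Pure Appl. Math. 9 (1956)); everything is proved from Mathlib and the
sibling tools files of the line.
-/

noncomputable section

open Set Function Filter Topology InnerProductSpace Literature.Analysis.FluidPDE
open ContinuousLinearMap (adjoint)
open scoped InnerProductSpace RealInnerProductSpace

namespace Summit.NavierStokesRegularity.NavierStokesRegularity.Theorems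

set_option linter.dupNamespace false

local notation3 "E3" => EuclideanSpace ℝ (Fin 3)

local notation3 "𝐞[" i "]" => (EuclideanSpace.single (i : Fin 3) (1:ℝ) : EuclideanSpace ℝ (Fin 3))

/-! ## Linear algebra of the step `g ↦ T(M g)` -/

/-- The six-point average is linear: the average of `f − g − h` is the corresponding difference
of averages. [folklore] -/
theorem tautLoopSplit_six_sub_sub (f g h : E3 → E3) (c : ℝ) (y : E3) :
    (1 / 6 : ℝ) • (∑ i : Fin 3, ((f (y + c • 𝐞[i]) - g (y + c • 𝐞[i]) - h (y + c • 𝐞[i])) +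
        (f (y - c • 𝐞[i]) - g (y - c • 𝐞[i]) - h (y - c • 𝐞[i])))) =
      (1 / 6 : ℝ) • (∑ i : Fin 3, (f (y + c • 𝐞[i]) + f (y - c • 𝐞[i]))) -
        (1 / 6 : ℝ) • (∑ i : Fin 3, (g (y + c • 𝐞[i]) + g (y - c • 𝐞[i]))) -
        (1 / 6 : ℝ) • (∑ i : Fin 3, (h (y + c • 𝐞[i]) + h (y - c • 𝐞[i]))) := by
  simp only [Fin.sum_univ_three, smul_add, smul_sub]
  abel

/-- Gradient of the sum of two differentiable scalar functions. [folklore] -/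
theorem tautLoopSplit_gradient_add {f g : E3 → ℝ} {x : E3} (hf : DifferentiableAt ℝ f x)
    (hg : DifferentiableAt ℝ g x) :
    gradient (fun y => f y + g y) x = gradient f x + gradient g x := by
  simp only [gradient, fderiv_fun_add hf hg, map_add]

/-- Adjoint chain rule for gradients: `(DA(x))† ∇R(A x) = ∇(R ∘ A)(x)` (both sides pair with
`v` to `DR(A x)(DA(x) v)`). [folklore] -/
private theorem tautLoopSplit_adjoint_gradient_comp {R : E3 → ℝ} {A : E3 → E3} {x : E3}
    (hR : DifferentiableAt ℝ R (A x)) (hA : DifferentiableAt ℝ A x) :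
    adjoint (fderiv ℝ A x) (gradient R (A x)) = gradient (fun y => R (A y)) x := by
  have h : HasFDerivAt (fun y => R (A y)) ((fderiv ℝ R (A x)).comp (fderiv ℝ A x)) x :=
    hR.hasFDerivAt.comp x hA.hasFDerivAt
  refine ext_inner_right ℝ fun v => ?_
  rw [ContinuousLinearMap.adjoint_inner_left, inner_gradient_left, inner_gradient_left, h.fderiv,
    ContinuousLinearMap.comp_apply]

/-- The six-point average `M Q` of a differentiable scalar `Q` is differentiable. [folklore] -/
theorem tautLoopSplit_msc_differentiable (Q : E3 → ℝ) (c : ℝ) (hQ : Differentiable ℝ Q) :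
    Differentiable ℝ (fun y => (1 / 6 : ℝ) *
      (∑ i : Fin 3, (Q (y + c • 𝐞[i]) + Q (y - c • 𝐞[i])))) := by
  refine (Differentiable.fun_sum fun i _ => ?_).const_mul _
  exact (hQ.comp (differentiable_id.add_const (c • 𝐞[i]))).add
    (hQ.comp (differentiable_id.sub_const (c • 𝐞[i])))

/-- **Gradients are transported to gradients**: for differentiable `Q` and `A`,
`(DA(x))† (M ∇Q)(A x) = ∇((M Q) ∘ A)(x)` (`M ∇Q = ∇(M Q)` by `tautLoopSix_gradient_average`,
then the adjoint chain rule). [folklore] -/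
theorem tautLoopSplit_TM_gradient (Q : E3 → ℝ) (A : E3 → E3) (c : ℝ) (hQ : Differentiable ℝ Q)
    (hA : Differentiable ℝ A) (x : E3) :
    adjoint (fderiv ℝ A x) ((1 / 6 : ℝ) • (∑ i : Fin 3, (gradient Q (A x + c • 𝐞[i]) +
      gradient Q (A x - c • 𝐞[i])))) =
      gradient (fun y => (1 / 6 : ℝ) *
        (∑ i : Fin 3, (Q (A y + c • 𝐞[i]) + Q (A y - c • 𝐞[i])))) x := by
  rw [← tautLoopSix_gradient_average Q c hQ (A x)]
  exact tautLoopSplit_adjoint_gradient_comp (tautLoopSplit_msc_differentiable Q c hQ _) (hA x)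

/-- **Sup-norm stability** of "average then transport": if `‖e‖ ≤ ε` everywhere and
`‖DA(x)‖ ≤ L`, then `‖(DA(x))† (M e)(A x)‖ ≤ L ε` (`‖L†‖ = ‖L‖` and `tautLoopSix_sup_le`).
[folklore] -/
theorem tautLoopSplit_TM_norm_le (e A : E3 → E3) (c ε L : ℝ) (x : E3) (he : ∀ y, ‖e y‖ ≤ ε)
    (hL : ‖fderiv ℝ A x‖ ≤ L) :
    ‖adjoint (fderiv ℝ A x) ((1 / 6 : ℝ) • (∑ i : Fin 3, (e (A x + c • 𝐞[i]) +
      e (A x - c • 𝐞[i]))))‖ ≤ L * ε := by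
  refine ((adjoint (fderiv ℝ A x)).le_opNorm _).trans ?_
  rw [ContinuousLinearMap.adjoint.norm_map]
  exact mul_le_mul hL (tautLoopSix_sup_le e c ε he (A x)) (norm_nonneg _)
    ((norm_nonneg _).trans hL)

/-! ## The discrete Duhamel induction -/

/-- **Consistency + stability ⇒ convergence, modulo gradients.** Let `θₖ₊₁ = Tₖ(M θₖ)` with
`Tₖ g(x) = (DAₖ(x))† g(Aₖ x)`, `θ₀ = v₀`, where each `Aₖ` is differentiable with `‖DAₖ‖ ≤ L`
(`L ≥ 1`) and the one-step consistency `‖Tₖ(M vₖ) − vₖ₊₁ − ∇qₖ‖ ≤ ρ` holds with differentiable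
`qₖ`. Then for every `k ≤ n` there is a differentiable `Q` with `‖θₖ − vₖ − ∇Q‖ ≤ k ρ Lᵏ`
pointwise (`Q₀ = 0`, `Qₖ₊₁ = qₖ + (M Qₖ) ∘ Aₖ`; the error obeys `εₖ₊₁ ≤ L εₖ + ρ`). [folklore] -/
theorem tautLoopSplit_induction (A θ v : ℕ → E3 → E3) (q : ℕ → E3 → ℝ) (c ρ L : ℝ) (n : ℕ)
    (hL : 1 ≤ L) (hρ : 0 ≤ ρ) (hA : ∀ k < n, Differentiable ℝ (A k))
    (hAL : ∀ k < n, ∀ x, ‖fderiv ℝ (A k) x‖ ≤ L) (hq : ∀ k < n, Differentiable ℝ (q k))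
    (hcons : ∀ k < n, ∀ x, ‖adjoint (fderiv ℝ (A k) x) ((1 / 6 : ℝ) • (∑ i : Fin 3,
      (v k (A k x + c • 𝐞[i]) + v k (A k x - c • 𝐞[i])))) - v (k + 1) x - gradient (q k) x‖ ≤ ρ)
    (hθ0 : θ 0 = v 0)
    (hθ : ∀ k < n, ∀ x, θ (k + 1) x = adjoint (fderiv ℝ (A k) x) ((1 / 6 : ℝ) • (∑ i : Fin 3,
      (θ k (A k x + c • 𝐞[i]) + θ k (A k x - c • 𝐞[i]))))) :
    ∀ k ≤ n, ∃ Q : E3 → ℝ, Differentiable ℝ Q ∧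
      ∀ x, ‖θ k x - v k x - gradient Q x‖ ≤ k * ρ * L ^ k := by
  intro k
  induction k with
  | zero =>
    intro _
    refine ⟨fun _ => 0, differentiable_const _, fun x => ?_⟩
    simp [hθ0, gradient_fun_const]
  | succ k ih =>
    intro hk
    have hkn : k < n := Nat.lt_of_succ_le hk
    obtain ⟨Q, hQd, hQ⟩ := ih hkn.le
    have hMAd : Differentiable ℝ (fun x => (1 / 6 : ℝ) * (∑ i : Fin 3,
        (Q (A k x + c • 𝐞[i]) + Q (A k x - c • 𝐞[i])))) :=
      (tautLoopSplit_msc_differentiable Q c hQd).comp (hA k hkn)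
    refine ⟨fun x => q k x + (1 / 6 : ℝ) * (∑ i : Fin 3,
        (Q (A k x + c • 𝐞[i]) + Q (A k x - c • 𝐞[i]))), (hq k hkn).add hMAd, fun x => ?_⟩
    -- decomposition of the error: `E' = T(M E) + r` (the gradient parts match exactly)
    have key : θ (k + 1) x - v (k + 1) x - gradient (fun x => q k x + (1 / 6 : ℝ) *
        (∑ i : Fin 3, (Q (A k x + c • 𝐞[i]) + Q (A k x - c • 𝐞[i])))) x =
        adjoint (fderiv ℝ (A k) x) ((1 / 6 : ℝ) • (∑ i : Fin 3,
          ((θ k (A k x + c • 𝐞[i]) - v k (A k x + c • 𝐞[i]) - gradient Q (A k x + c • 𝐞[i])) +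
           (θ k (A k x - c • 𝐞[i]) - v k (A k x - c • 𝐞[i]) - gradient Q (A k x - c • 𝐞[i]))))) +
        (adjoint (fderiv ℝ (A k) x) ((1 / 6 : ℝ) • (∑ i : Fin 3,
          (v k (A k x + c • 𝐞[i]) + v k (A k x - c • 𝐞[i])))) - v (k + 1) x -
          gradient (q k) x) := by
      rw [hθ k hkn x, tautLoopSplit_gradient_add ((hq k hkn) x) (hMAd x),
        ← tautLoopSplit_TM_gradient Q (A k) c hQd (hA k hkn) x, tautLoopSplit_six_sub_sub,
        map_sub, map_sub]
      abel
    rw [key]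
    have h1 := tautLoopSplit_TM_norm_le (fun y => θ k y - v k y - gradient Q y) (A k) c
      (k * ρ * L ^ k) L x hQ (hAL k hkn x)
    calc _ ≤ L * (k * ρ * L ^ k) + ρ := norm_add_le_of_le h1 (hcons k hkn x)
      _ ≤ ((k + 1 : ℕ) : ℝ) * ρ * L ^ (k + 1) := by
        have hLk : ρ * 1 ≤ ρ * L ^ (k + 1) := mul_le_mul_of_nonneg_left (one_le_pow₀ hL) hρ
        have e : ((k + 1 : ℕ) : ℝ) * ρ * L ^ (k + 1) =
            L * (k * ρ * L ^ k) + ρ * L ^ (k + 1) := by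
          push_cast
          ring
        rw [e]
        linarith

/-! ## The registered tools stub -/

/-- **Tools stub `stub_tautLoopStepSplittingTools`** (registered signature, verbatim): after `n`
steps of "six-point average then backward-flow transport" started at `u(a)`, the scheme equals
`u(b) + ∇Q` up to `K (b − a)²/n` in sup norm, `K = K(ν, B₀, …, B₄, Bt)` (one-step consistency
`stub_tautLoopStepOneStepTools` on each sub-interval, stability `‖DXₖ(sₖ)‖ ≤ e^{B₁ τ}`, and the
discrete Duhamel induction `tautLoopSplit_induction`; `K = K₁ e^{B₁}`). [folklore] -/
theorem stub_tautLoopStepSplittingTools : ∀ (ν B₀ B₁ B₂ B₃ B₄ Bt : ℝ), 0 < ν → 0 ≤ B₀ →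
    0 ≤ B₁ → 0 ≤ B₂ → 0 ≤ B₃ → 0 ≤ B₄ → 0 ≤ Bt → ∃ K : ℝ, 0 ≤ K ∧
    ∀ (u : ℝ → EuclideanSpace ℝ (Fin 3) → EuclideanSpace ℝ (Fin 3))
    (p : ℝ → EuclideanSpace ℝ (Fin 3) → ℝ) (a b : ℝ) (n : ℕ), 0 < n → a < b → b - a ≤ 1 →
    Literature.Analysis.FluidPDE.IsClassicalNSSolutionOn (Set.Icc a b) ν 0 u p →
    (∀ r ∈ Set.Icc a b, ∀ x, ‖u r x‖ ≤ B₀) → (∀ r ∈ Set.Icc a b, ∀ x, ‖fderiv ℝ (u r) x‖ ≤ B₁) →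
    (∀ r ∈ Set.Icc a b, ∀ x, ‖iteratedFDeriv ℝ 2 (u r) x‖ ≤ B₂) →
    (∀ r ∈ Set.Icc a b, ∀ x, ‖iteratedFDeriv ℝ 3 (u r) x‖ ≤ B₃) →
    (∀ r ∈ Set.Icc a b, ∀ x, ‖iteratedFDeriv ℝ 4 (u r) x‖ ≤ B₄) →
    (∀ r ∈ Set.Icc a b, ∀ r' ∈ Set.Icc a b, ∀ x, ‖u r' x - u r x‖ ≤ Bt * |r' - r|) →
    (∀ r ∈ Set.Icc a b, ∀ r' ∈ Set.Icc a b, ∀ x,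
      ‖fderiv ℝ (u r') x - fderiv ℝ (u r) x‖ ≤ Bt * |r' - r|) →
    (∀ r ∈ Set.Icc a b, ∀ r' ∈ Set.Icc a b, ∀ x,
      ‖iteratedFDeriv ℝ 2 (u r') x - iteratedFDeriv ℝ 2 (u r) x‖ ≤ Bt * |r' - r|) →
    ∀ (X : ℕ → ℝ → EuclideanSpace ℝ (Fin 3) → EuclideanSpace ℝ (Fin 3))
    (θ : ℕ → EuclideanSpace ℝ (Fin 3) → EuclideanSpace ℝ (Fin 3)),
    (∀ k : ℕ, k < n → Literature.Analysis.FluidPDE.IsSmoothSpaceTimeOn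
      (Set.Icc (a + k * ((b - a) / n)) (a + (k + 1) * ((b - a) / n))) (X k) ∧
      (∀ r ∈ Set.Icc (a + k * ((b - a) / n)) (a + (k + 1) * ((b - a) / n)), ∀ y,
        HasDerivWithinAt (fun r' => X k r' y) (u r (X k r y))
          (Set.Icc (a + k * ((b - a) / n)) (a + (k + 1) * ((b - a) / n))) r) ∧
      (∀ y, X k (a + (k + 1) * ((b - a) / n)) y = y)) →
    (θ 0 = u a) →
    (∀ k : ℕ, k < n → ∀ x, θ (k + 1) x =
      ContinuousLinearMap.adjoint (fderiv ℝ (X k (a + k * ((b - a) / n))) x) ((1 / 6 : ℝ) •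
        (∑ i : Fin 3, (θ k (X k (a + k * ((b - a) / n)) x +
          Real.sqrt (6 * ν * ((b - a) / n)) • EuclideanSpace.single i (1:ℝ)) +
          θ k (X k (a + k * ((b - a) / n)) x -
          Real.sqrt (6 * ν * ((b - a) / n)) • EuclideanSpace.single i (1:ℝ)))))) →
    ∃ Q : EuclideanSpace ℝ (Fin 3) → ℝ, Differentiable ℝ Q ∧
      ∀ x, ‖θ n x - u b x - gradient Q x‖ ≤ K * (b - a) ^ 2 / n := by
  intro ν B₀ B₁ B₂ B₃ B₄ Bt hν hB₀ hB₁ hB₂ hB₃ hB₄ hBt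
  obtain ⟨K₁, hK₁0, h1⟩ :=
    stub_tautLoopStepOneStepTools ν B₀ B₁ B₂ B₃ B₄ Bt hν hB₀ hB₁ hB₂ hB₃ hB₄ hBt
  refine ⟨K₁ * Real.exp B₁, by positivity, ?_⟩
  intro u p a b n hn hab hba1 hNS hu0 hu1 hu2 hu3 hu4 hut hDut hD2ut X θ hX hθ0 hθ
  set τ : ℝ := (b - a) / n with hτ
  have hn0 : (0 : ℝ) < n := Nat.cast_pos.2 hn
  have hτ0 : 0 < τ := div_pos (sub_pos.2 hab) hn0
  have hnτ : (n : ℝ) * τ = b - a := by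
    rw [hτ]; field_simp
  have hτ1 : τ ≤ 1 := by
    rw [hτ, div_le_one hn0]
    exact hba1.trans (Nat.one_le_cast.2 hn)
  -- the sub-intervals `[a + k τ, a + (k + 1) τ]`
  have hsk : ∀ k : ℕ, a + ((k : ℝ) + 1) * τ - (a + k * τ) = τ := fun k => by ring
  have hlt : ∀ k : ℕ, a + (k : ℝ) * τ < a + ((k : ℝ) + 1) * τ := fun k => by
    linarith [hsk k]
  have hsub : ∀ k : ℕ, k < n → Set.Icc (a + (k : ℝ) * τ) (a + ((k : ℝ) + 1) * τ) ⊆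
      Set.Icc a b := by
    intro k hk
    have hk1 : (k : ℝ) + 1 ≤ n := by exact_mod_cast hk
    refine Set.Icc_subset_Icc (le_add_of_nonneg_right (mul_nonneg k.cast_nonneg hτ0.le)) ?_
    calc a + ((k : ℝ) + 1) * τ ≤ a + (n : ℝ) * τ := by gcongr
      _ = b := by rw [hnτ]; ring
  -- one-step consistency on each sub-interval
  have hone : ∀ k : ℕ, k < n → ∃ qk : E3 → ℝ, Differentiable ℝ qk ∧ ∀ x,
      ‖adjoint (fderiv ℝ (X k (a + k * τ)) x) ((1 / 6 : ℝ) • (∑ i : Fin 3,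
        (u (a + k * τ) (X k (a + k * τ) x + Real.sqrt (6 * ν * τ) • 𝐞[i]) +
          u (a + k * τ) (X k (a + k * τ) x - Real.sqrt (6 * ν * τ) • 𝐞[i])))) -
        u (a + ((k : ℝ) + 1) * τ) x - gradient qk x‖ ≤ K₁ * τ ^ 2 := by
    intro k hk
    obtain ⟨hXk, hXuk, hXbk⟩ := hX k hk
    have h := h1 u p (X k) (a + k * τ) (a + ((k : ℝ) + 1) * τ) (hlt k)
      (by rw [hsk k]; exact hτ1) (hNS.mono (hsub k hk) (uniqueDiffOn_Icc (hlt k))) hXk hXuk hXbk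
      (fun r hr => hu0 r (hsub k hk hr)) (fun r hr => hu1 r (hsub k hk hr))
      (fun r hr => hu2 r (hsub k hk hr)) (fun r hr => hu3 r (hsub k hk hr))
      (fun r hr => hu4 r (hsub k hk hr))
      (fun r hr r' hr' => hut r (hsub k hk hr) r' (hsub k hk hr'))
      (fun r hr r' hr' => hDut r (hsub k hk hr) r' (hsub k hk hr'))
      (fun r hr r' hr' => hD2ut r (hsub k hk hr) r' (hsub k hk hr'))
    rwa [hsk k] at h
  choose! qf hqd hqb using hone
  -- stability: `‖DXₖ(sₖ)‖ ≤ e^{B₁ τ}`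
  have hAL : ∀ k : ℕ, k < n → ∀ x, ‖fderiv ℝ (X k (a + k * τ)) x‖ ≤ Real.exp (B₁ * τ) := by
    intro k hk x
    obtain ⟨hXk, hXuk, hXbk⟩ := hX k hk
    refine ContinuousLinearMap.opNorm_le_bound _ (by positivity) fun w => ?_
    have h := tautLoopFlowT_fderiv_apply_le (hlt k) (hNS.smooth_velocity.mono (hsub k hk)) hXk
      hXuk hXbk (fun r hr => hu1 r (hsub k hk hr)) hB₁ (Set.left_mem_Icc.2 (hlt k).le) x w
    rwa [hsk k] at h
  have hAd : ∀ k : ℕ, k < n → Differentiable ℝ (X k (a + k * τ)) := fun k hk =>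
    ((hX k hk).1.contDiff_slice (Set.left_mem_Icc.2 (hlt k).le)).differentiable (by simp)
  have hcons : ∀ k : ℕ, k < n → ∀ x,
      ‖adjoint (fderiv ℝ (X k (a + k * τ)) x) ((1 / 6 : ℝ) • (∑ i : Fin 3,
        (u (a + k * τ) (X k (a + k * τ) x + Real.sqrt (6 * ν * τ) • 𝐞[i]) +
          u (a + k * τ) (X k (a + k * τ) x - Real.sqrt (6 * ν * τ) • 𝐞[i])))) -
        u (a + ((k + 1 : ℕ) : ℝ) * τ) x - gradient (qf k) x‖ ≤ K₁ * τ ^ 2 := by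
    intro k hk x
    push_cast
    exact hqb k hk x
  -- the discrete Duhamel induction
  obtain ⟨Q, hQd, hQ⟩ := tautLoopSplit_induction (fun k => X k (a + k * τ)) θ
    (fun k => u (a + k * τ)) qf (Real.sqrt (6 * ν * τ)) (K₁ * τ ^ 2) (Real.exp (B₁ * τ)) n
    (Real.one_le_exp (by positivity)) (by positivity) hAd hAL hqd hcons (by rw [hθ0]; simp) hθ n
    le_rfl
  refine ⟨Q, hQd, fun x => ?_⟩
  have hQx := hQ x
  have hnb : a + (n : ℝ) * τ = b := by rw [hnτ]; ring
  simp only [hnb] at hQx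
  refine hQx.trans ?_
  -- `n K₁ τ² e^{B₁ τ n} ≤ K₁ e^{B₁} (b − a)² / n`
  have hpow : Real.exp (B₁ * τ) ^ n = Real.exp (B₁ * (b - a)) := by
    rw [← Real.exp_nat_mul, ← hnτ]; ring_nf
  have hexp : Real.exp (B₁ * (b - a)) ≤ Real.exp B₁ :=
    Real.exp_le_exp.2 (mul_le_of_le_one_right hB₁ hba1)
  have hnK : (n : ℝ) * (K₁ * τ ^ 2) = K₁ * (b - a) ^ 2 / n := by
    rw [hτ]; field_simp
  rw [hpow, hnK]
  calc K₁ * (b - a) ^ 2 / n * Real.exp (B₁ * (b - a)) ≤ K₁ * (b - a) ^ 2 / n * Real.exp B₁ := by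
        gcongr
    _ = K₁ * Real.exp B₁ * (b - a) ^ 2 / n := by ring

end Summit.NavierStokesRegularity.NavierStokesRegularity.Theorems

end
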